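import Summits.KontsevichZagierPeriods.KontsevichZagierPeriods.Theorems.SoloBlindLandenSecond
import HarnessLib

/-!
# Landen's transformation inside the rules, III: towers, and the lemniscatic modulus

One Landen step, up or down, keeps `([K], [E])` inside any sub-`K₀`-algebra of `Q`
(`landen_ascend_mem`, `landen_descend_mem`, by Landen I/II and invertibility of `1+k`, `2` in
`K₀`); by induction the whole ascending tower `k₀ = k`, `k_{n+1} = 2√k_n/(1+k_n)` (`landenSeq`,
algebraic, in `(0,1)`) does (`landen_tower_mem`).  At the lemniscatic modulus `k = √2/2`
(`kL`, `λ(k_L) = 12√2 - 16`): `[K_½] = √2·[A₂]`, `[E_½] = (√2/2)·([A₂] + [B₂])` against Legendre's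
integer normal forms (`mkQ_ellK_half`, `mkQ_ellE_half`), and `[K_{λ₁}] = (1+√2)·[A₂]`
(`mkQ_ellK_landenOne`), so `K(k₁) = (1+√2)·∫₀¹dx/√(1-x⁴)` is transcendental.
-/

noncomputable section

namespace Summit.KontsevichZagierPeriods.KontsevichZagierPeriods.Theorems

open Set MeasureTheory
open Literature.ModelTheory.ExponentialFields (IsSemialgebraic)
open Literature.NumberTheory.Transcendental
open Literature.NumberTheory.Transcendental.KZ

namespace SoloBlind

section SecondKind

section

variable (k : ℝ) (hka : IsAlgebraic ℚ k) (hk : k ∈ Ioo (0:ℝ) 1)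

/-! ## Landen orbits stay inside sub-`K₀`-algebras of `Q` -/

include hk in
/-- `1 + k ≠ 0` in `K₀`. -/
theorem one_add_ne_zero_K₀ :
    (⟨1 + k, mem_K₀_iff.mpr (isAlgebraic_one.add hka)⟩ : K₀) ≠ 0 := by
  intro h0
  have h1 := congrArg Subtype.val h0
  change 1 + k = 0 at h1
  linarith [hk.1]

/-- **Ascending step.** If `[K_{k²}]` and `[E_{k²}]` lie in a sub-`K₀`-algebra `S` of `Q`, so do
`[K_λ]` and `[E_λ]`, `λ = 4k/(1+k)²` (by Landen I and II). -/
theorem landen_ascend_mem (S : Subalgebra K₀ Q)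
    (hK : mkQ (of (ellK (k ^ 2) (hka.pow 2) (sq_mem_Ioo k hk))) ∈ S)
    (hE : mkQ (of (ellE (k ^ 2) (hka.pow 2) (sq_mem_Ioo k hk))) ∈ S) :
    mkQ (of (ellK (landenMod k) (isAlgebraic_landenMod hka) (landenMod_mem hk))) ∈ S ∧
      mkQ (of (ellE (landenMod k) (isAlgebraic_landenMod hka) (landenMod_mem hk))) ∈ S := by
  refine ⟨by rw [mkQ_ellK_landen k hka hk]; exact S.smul_mem hK _, ?_⟩
  set c : K₀ := ⟨1 + k, mem_K₀_iff.mpr (isAlgebraic_one.add hka)⟩ with hc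
  have hc0 : c ≠ 0 := one_add_ne_zero_K₀ k hka hk
  have h := mkQ_landen_second k hka hk
  have h' : mkQ (of (ellE (landenMod k) (isAlgebraic_landenMod hka) (landenMod_mem hk))) =
      c⁻¹ • ((⟨2, mem_K₀_iff.mpr (isAlgebraic_nat 2)⟩ : K₀) •
        mkQ (of (ellE (k ^ 2) (hka.pow 2) (sq_mem_Ioo k hk))) -
      (⟨1 - k ^ 2, mem_K₀_iff.mpr (isAlgebraic_one.sub (hka.pow 2))⟩ : K₀) •
        mkQ (of (ellK (k ^ 2) (hka.pow 2) (sq_mem_Ioo k hk)))) := by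
    rw [← h, add_sub_cancel_right, ← hc, inv_smul_smul₀ hc0]
  rw [h']
  exact S.smul_mem (S.sub_mem (S.smul_mem hE _) (S.smul_mem hK _)) _

/-- **Descending step.** If `[K_λ]` and `[E_λ]` lie in a sub-`K₀`-algebra `S` of `Q`, so do
`[K_{k²}]` and `[E_{k²}]`. -/
theorem landen_descend_mem (S : Subalgebra K₀ Q)
    (hK : mkQ (of (ellK (landenMod k) (isAlgebraic_landenMod hka) (landenMod_mem hk))) ∈ S)
    (hE : mkQ (of (ellE (landenMod k) (isAlgebraic_landenMod hka) (landenMod_mem hk))) ∈ S) :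
    mkQ (of (ellK (k ^ 2) (hka.pow 2) (sq_mem_Ioo k hk))) ∈ S ∧
      mkQ (of (ellE (k ^ 2) (hka.pow 2) (sq_mem_Ioo k hk))) ∈ S := by
  set c : K₀ := ⟨1 + k, mem_K₀_iff.mpr (isAlgebraic_one.add hka)⟩ with hc
  have hc0 : c ≠ 0 := one_add_ne_zero_K₀ k hka hk
  have hK' : mkQ (of (ellK (k ^ 2) (hka.pow 2) (sq_mem_Ioo k hk))) ∈ S := by
    have h1 : mkQ (of (ellK (k ^ 2) (hka.pow 2) (sq_mem_Ioo k hk))) =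
        c⁻¹ • mkQ (of (ellK (landenMod k) (isAlgebraic_landenMod hka) (landenMod_mem hk))) := by
      rw [mkQ_ellK_landen k hka hk, ← hc, inv_smul_smul₀ hc0]
    rw [h1]
    exact S.smul_mem hK _
  refine ⟨hK', ?_⟩
  set e : K₀ := ⟨2, mem_K₀_iff.mpr (isAlgebraic_nat 2)⟩ with he
  have he0 : e ≠ 0 := by
    intro h0
    have h1 := congrArg Subtype.val h0
    change (2:ℝ) = 0 at h1
    norm_num at h1
  have h := mkQ_landen_second k hka hk
  have h' : mkQ (of (ellE (k ^ 2) (hka.pow 2) (sq_mem_Ioo k hk))) =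
      e⁻¹ • (c • mkQ (of (ellE (landenMod k) (isAlgebraic_landenMod hka) (landenMod_mem hk))) +
        (⟨1 - k ^ 2, mem_K₀_iff.mpr (isAlgebraic_one.sub (hka.pow 2))⟩ : K₀) •
          mkQ (of (ellK (k ^ 2) (hka.pow 2) (sq_mem_Ioo k hk)))) := by
    rw [hc, h, ← he, inv_smul_smul₀ he0]
  rw [h']
  exact S.smul_mem (S.add_mem (S.smul_mem hE _) (S.smul_mem hK' _)) _

end

/-- `ellK` only depends on the modulus. -/
theorem ellK_congr {μ μ' : ℝ} (h : μ = μ') {ha : IsAlgebraic ℚ μ} {hμ : μ ∈ Ioo (0:ℝ) 1}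
    {ha' : IsAlgebraic ℚ μ'} {hμ' : μ' ∈ Ioo (0:ℝ) 1} : ellK μ ha hμ = ellK μ' ha' hμ' := by
  subst h; rfl

/-- `ellE` only depends on the modulus. -/
theorem ellE_congr {μ μ' : ℝ} (h : μ = μ') {ha : IsAlgebraic ℚ μ} {hμ : μ ∈ Ioo (0:ℝ) 1}
    {ha' : IsAlgebraic ℚ μ'} {hμ' : μ' ∈ Ioo (0:ℝ) 1} : ellE μ ha hμ = ellE μ' ha' hμ' := by
  subst h; rfl

/-! ## The ascending Landen tower -/

/-- The ascending Landen tower `k₀ = k`, `k_{n+1} = √(λ(k_n)) = 2√k_n/(1+k_n)`. -/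
def landenSeq (k : ℝ) : ℕ → ℝ
  | 0 => k
  | n + 1 => Real.sqrt (landenMod (landenSeq k n))

/-- `landenSeq k 0 = k`. -/
@[simp] theorem landenSeq_zero (k : ℝ) : landenSeq k 0 = k := rfl

/-- `landenSeq k (n+1) = √(λ(landenSeq k n))`. -/
theorem landenSeq_succ (k : ℝ) (n : ℕ) :
    landenSeq k (n + 1) = Real.sqrt (landenMod (landenSeq k n)) := rfl

/-- Every member of the tower lies in `(0,1)`. -/
theorem landenSeq_mem {k : ℝ} (hk : k ∈ Ioo (0:ℝ) 1) : ∀ n, landenSeq k n ∈ Ioo (0:ℝ) 1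
  | 0 => hk
  | n + 1 => by
    have h := landenMod_mem (landenSeq_mem hk n)
    rw [landenSeq_succ]
    exact ⟨Real.sqrt_pos.mpr h.1, (Real.sqrt_lt' one_pos).mpr (by simpa using h.2)⟩

/-- `k_{n+1}² = λ(k_n)`. -/
theorem landenSeq_succ_sq {k : ℝ} (hk : k ∈ Ioo (0:ℝ) 1) (n : ℕ) :
    landenSeq k (n + 1) ^ 2 = landenMod (landenSeq k n) := by
  rw [landenSeq_succ, Real.sq_sqrt (landenMod_mem (landenSeq_mem hk n)).1.le]

/-- Every member of the tower is algebraic (if `k` is). -/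
theorem isAlgebraic_landenSeq {k : ℝ} (hka : IsAlgebraic ℚ k) (hk : k ∈ Ioo (0:ℝ) 1) :
    ∀ n, IsAlgebraic ℚ (landenSeq k n)
  | 0 => hka
  | n + 1 => IsAlgebraic.of_pow two_pos (by
      rw [landenSeq_succ_sq hk n]; exact isAlgebraic_landenMod (isAlgebraic_landenSeq hka hk n))

/-- **The Landen tower stays in the sector.** If `[K_{k²}], [E_{k²}]` lie in a sub-`K₀`-algebra `S`
of `Q`, then so do `[K_{k_n²}], [E_{k_n²}]` for the whole ascending tower `k_n = landenSeq k n`. -/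
theorem landen_tower_mem {k : ℝ} (hka : IsAlgebraic ℚ k) (hk : k ∈ Ioo (0:ℝ) 1)
    (S : Subalgebra K₀ Q)
    (hK : mkQ (of (ellK (k ^ 2) (hka.pow 2) (sq_mem_Ioo k hk))) ∈ S)
    (hE : mkQ (of (ellE (k ^ 2) (hka.pow 2) (sq_mem_Ioo k hk))) ∈ S) :
    ∀ n, mkQ (of (ellK (landenSeq k n ^ 2) ((isAlgebraic_landenSeq hka hk n).pow 2)
        (sq_mem_Ioo _ (landenSeq_mem hk n)))) ∈ S ∧
      mkQ (of (ellE (landenSeq k n ^ 2) ((isAlgebraic_landenSeq hka hk n).pow 2)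
        (sq_mem_Ioo _ (landenSeq_mem hk n)))) ∈ S
  | 0 => ⟨hK, hE⟩
  | n + 1 => by
    have h := landen_ascend_mem (landenSeq k n) (isAlgebraic_landenSeq hka hk n)
      (landenSeq_mem hk n) S (landen_tower_mem hka hk S hK hE n).1
      (landen_tower_mem hka hk S hK hE n).2
    rw [ellK_congr (landenSeq_succ_sq hk n).symm
        (ha' := (isAlgebraic_landenSeq hka hk (n + 1)).pow 2)
        (hμ' := sq_mem_Ioo _ (landenSeq_mem hk (n + 1))),
      ellE_congr (landenSeq_succ_sq hk n).symm
        (ha' := (isAlgebraic_landenSeq hka hk (n + 1)).pow 2)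
        (hμ' := sq_mem_Ioo _ (landenSeq_mem hk (n + 1)))] at h
    exact h

/-! ## The inverse Landen step and the descending tower -/

/-- The inverse Landen modulus `k(λ) = (1 - √(1-λ))/(1 + √(1-λ))`, so that `λ(k(λ)) = λ`. -/
def landenInv (l : ℝ) : ℝ := (1 - Real.sqrt (1 - l)) / (1 + Real.sqrt (1 - l))

/-- `k(λ) ∈ (0,1)` for `λ ∈ (0,1)`. -/
theorem landenInv_mem {l : ℝ} (hl : l ∈ Ioo (0:ℝ) 1) : landenInv l ∈ Ioo (0:ℝ) 1 := by
  have hs0 : 0 < Real.sqrt (1 - l) := Real.sqrt_pos.mpr (by linarith [hl.2])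
  have hs1 : Real.sqrt (1 - l) < 1 := (Real.sqrt_lt' one_pos).mpr (by linarith [hl.1])
  have hd : 0 < 1 + Real.sqrt (1 - l) := by linarith
  exact ⟨div_pos (by linarith) hd, (div_lt_one hd).mpr (by linarith)⟩

/-- `k(λ)` is algebraic. -/
theorem isAlgebraic_landenInv {l : ℝ} (hla : IsAlgebraic ℚ l) (hl : l ∈ Ioo (0:ℝ) 1) :
    IsAlgebraic ℚ (landenInv l) := by
  have hs : IsAlgebraic ℚ (Real.sqrt (1 - l)) := IsAlgebraic.of_pow two_pos (by
    rw [Real.sq_sqrt (by linarith [hl.2])]; exact isAlgebraic_one.sub hla)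
  rw [landenInv, div_eq_mul_inv]
  exact (isAlgebraic_one.sub hs).mul (isAlgebraic_one.add hs).inv

/-- **`λ(k(λ)) = λ`.** -/
theorem landenMod_landenInv {l : ℝ} (hl : l ∈ Ioo (0:ℝ) 1) : landenMod (landenInv l) = l := by
  have hs : Real.sqrt (1 - l) ^ 2 = 1 - l := Real.sq_sqrt (by linarith [hl.2])
  have hs0 : 0 ≤ Real.sqrt (1 - l) := Real.sqrt_nonneg _
  have hd : (1 + Real.sqrt (1 - l)) ≠ 0 := by positivity
  have hk1 : 1 + landenInv l = 2 / (1 + Real.sqrt (1 - l)) := by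
    rw [landenInv]; field_simp; ring
  rw [landenMod, hk1, landenInv]
  field_simp
  nlinarith [hs]

/-- **Descending step at a given modulus.** If `[K_λ], [E_λ]` lie in a sub-`K₀`-algebra `S` of `Q`,
so do `[K_{k(λ)²}], [E_{k(λ)²}]`. -/
theorem landen_descend_mem' {l : ℝ} (hla : IsAlgebraic ℚ l) (hl : l ∈ Ioo (0:ℝ) 1)
    (S : Subalgebra K₀ Q) (hK : mkQ (of (ellK l hla hl)) ∈ S) (hE : mkQ (of (ellE l hla hl)) ∈ S) :
    mkQ (of (ellK (landenInv l ^ 2) ((isAlgebraic_landenInv hla hl).pow 2)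
        (sq_mem_Ioo _ (landenInv_mem hl)))) ∈ S ∧
      mkQ (of (ellE (landenInv l ^ 2) ((isAlgebraic_landenInv hla hl).pow 2)
        (sq_mem_Ioo _ (landenInv_mem hl)))) ∈ S := by
  rw [ellK_congr (landenMod_landenInv hl).symm
      (ha' := isAlgebraic_landenMod (isAlgebraic_landenInv hla hl))
      (hμ' := landenMod_mem (landenInv_mem hl))] at hK
  rw [ellE_congr (landenMod_landenInv hl).symm
      (ha' := isAlgebraic_landenMod (isAlgebraic_landenInv hla hl))
      (hμ' := landenMod_mem (landenInv_mem hl))] at hE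
  exact landen_descend_mem (landenInv l) (isAlgebraic_landenInv hla hl) (landenInv_mem hl) S hK hE

/-- The descending tower of (squared) moduli `μ₀ = μ`, `μ_{n+1} = k(μ_n)²`. -/
def landenDesc (μ : ℝ) : ℕ → ℝ
  | 0 => μ
  | n + 1 => landenInv (landenDesc μ n) ^ 2

/-- `landenDesc μ 0 = μ`. -/
@[simp] theorem landenDesc_zero (μ : ℝ) : landenDesc μ 0 = μ := rfl

/-- `landenDesc μ (n+1) = k(landenDesc μ n)²`. -/
theorem landenDesc_succ (μ : ℝ) (n : ℕ) :
    landenDesc μ (n + 1) = landenInv (landenDesc μ n) ^ 2 := rfl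

/-- Every member of the descending tower lies in `(0,1)`. -/
theorem landenDesc_mem {μ : ℝ} (hμ : μ ∈ Ioo (0:ℝ) 1) : ∀ n, landenDesc μ n ∈ Ioo (0:ℝ) 1
  | 0 => hμ
  | n + 1 => sq_mem_Ioo _ (landenInv_mem (landenDesc_mem hμ n))

/-- Every member of the descending tower is algebraic. -/
theorem isAlgebraic_landenDesc {μ : ℝ} (hμa : IsAlgebraic ℚ μ) (hμ : μ ∈ Ioo (0:ℝ) 1) :
    ∀ n, IsAlgebraic ℚ (landenDesc μ n)
  | 0 => hμa
  | n + 1 => (isAlgebraic_landenInv (isAlgebraic_landenDesc hμa hμ n) (landenDesc_mem hμ n)).pow 2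

/-- **The descending Landen tower stays in the sector.** -/
theorem landen_desc_tower_mem {μ : ℝ} (hμa : IsAlgebraic ℚ μ) (hμ : μ ∈ Ioo (0:ℝ) 1)
    (S : Subalgebra K₀ Q) (hK : mkQ (of (ellK μ hμa hμ)) ∈ S)
    (hE : mkQ (of (ellE μ hμa hμ)) ∈ S) :
    ∀ n, mkQ (of (ellK (landenDesc μ n) (isAlgebraic_landenDesc hμa hμ n)
        (landenDesc_mem hμ n))) ∈ S ∧
      mkQ (of (ellE (landenDesc μ n) (isAlgebraic_landenDesc hμa hμ n)
        (landenDesc_mem hμ n))) ∈ S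
  | 0 => ⟨hK, hE⟩
  | n + 1 => landen_descend_mem' (isAlgebraic_landenDesc hμa hμ n) (landenDesc_mem hμ n) S
      (landen_desc_tower_mem hμa hμ S hK hE n).1 (landen_desc_tower_mem hμa hμ S hK hE n).2

end SecondKind

section LemniscaticOrbit

/-! ## The modulus `k = √2/2` -/

/-- `k_L = √2/2 = 1/√2`. -/
def kL : ℝ := Real.sqrt 2 / 2

/-- `k_L ∈ (0,1)`. -/
theorem kL_mem : kL ∈ Ioo (0:ℝ) 1 := by
  have h1 : Real.sqrt 2 < 2 := by
    rw [show (2:ℝ) = Real.sqrt 4 by rw [show (4:ℝ) = 2 ^ 2 by norm_num, Real.sqrt_sq zero_le_two]]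
    exact Real.sqrt_lt_sqrt (by norm_num) (by norm_num)
  exact ⟨by unfold kL; positivity, by unfold kL; linarith⟩

/-- `k_L² = ½`. -/
theorem kL_sq : kL ^ 2 = 1 / 2 := by
  rw [kL, div_pow, Real.sq_sqrt (by norm_num)]; norm_num

/-- `2 k_L = √2`. -/
theorem two_mul_kL : 2 * kL = Real.sqrt 2 := by
  unfold kL; ring

/-- `k_L` is algebraic (`k_L² = ½`). -/
theorem isAlgebraic_kL : IsAlgebraic ℚ kL :=
  IsAlgebraic.of_pow two_pos (by
    rw [kL_sq]
    have h : IsAlgebraic ℚ (((1 / 2 : ℚ)) : ℝ) := isAlgebraic_rat ℚ _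
    simpa using h)

/-- `√2 = 2k_L` as an element of `K₀ = ℚ̄ ∩ ℝ`. -/
def sqrtTwo : K₀ :=
  ⟨Real.sqrt 2, mem_K₀_iff.mpr (by rw [← two_mul_kL]; exact (isAlgebraic_nat 2).mul isAlgebraic_kL)⟩

/-- The value of `sqrtTwo`. -/
@[simp] theorem coe_sqrtTwo : (sqrtTwo : ℝ) = Real.sqrt 2 := rfl

/-- `√2 = ↑sqrtTwo` is algebraic. -/
theorem isAlgebraic_sqrtTwo : IsAlgebraic ℚ (sqrtTwo : ℝ) := mem_K₀_iff.mp sqrtTwo.2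

/-- **`λ₁ = 12√2 - 16`**: Landen's modulus at `k = 1/√2`. -/
theorem landenMod_kL : landenMod kL = 12 * Real.sqrt 2 - 16 := by
  have hs : Real.sqrt 2 * Real.sqrt 2 = 2 := Real.mul_self_sqrt zero_le_two
  have hD : (0:ℝ) < (1 + kL) ^ 2 := by have := kL_mem.1; positivity
  rw [landenMod, div_eq_iff hD.ne', kL]
  nlinarith [hs]

/-! ## `K_½`, `E_½` against Legendre's integer normal form -/

variable {x : ℝ}

/-- `f_½(x) = √2 · legK x` on `(0,1)`. -/
theorem ellKf_half (hx : x ∈ Ioo (0:ℝ) 1) : ellKf (kL ^ 2) x = Real.sqrt 2 * legK x := by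
  rw [kL_sq]
  have hP : 0 < 1 - x ^ 2 := by nlinarith [hx.1, hx.2]
  have hQ : 0 < 2 - x ^ 2 := by nlinarith [hx.1, hx.2]
  have hu : 0 < Real.sqrt ((1 - x ^ 2) * (1 - 1 / 2 * x ^ 2)) :=
    Real.sqrt_pos.mpr (mul_pos hP (by nlinarith))
  have hs : 0 < Real.sqrt 2 := Real.sqrt_pos.mpr two_pos
  rw [ellKf, legK, show (1 - x ^ 2) * (2 - x ^ 2) = 2 * ((1 - x ^ 2) * (1 - 1 / 2 * x ^ 2)) by ring,
    Real.sqrt_mul zero_le_two]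
  field_simp

/-- `e_½(x) = (√2/2) · legE x` on `(0,1)`. -/
theorem ellEf_half (hx : x ∈ Ioo (0:ℝ) 1) : ellEf (kL ^ 2) x = kL * legE x := by
  rw [kL_sq]
  have hP : 0 < 1 - x ^ 2 := by nlinarith [hx.1, hx.2]
  have hQ : 0 < 2 - x ^ 2 := by nlinarith [hx.1, hx.2]
  have hs : 0 < Real.sqrt 2 := Real.sqrt_pos.mpr two_pos
  rw [ellEf, legE, kL, show (1 - 1 / 2 * x ^ 2) / (1 - x ^ 2) = ((2 - x ^ 2) / (1 - x ^ 2)) / 2 by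
    field_simp, Real.sqrt_div' _ zero_le_two]
  field_simp
  rw [Real.sq_sqrt zero_le_two]

/-- `K_½ - √2·G_K ∈ relations` (equal integrands on `(0,1)`). -/
theorem ellK_half_sub :
    of (ellK (kL ^ 2) (isAlgebraic_kL.pow 2) (sq_mem_Ioo kL kL_mem)) -
      of (legK1.constMul (Real.sqrt 2) isAlgebraic_sqrtTwo) ∈ relations :=
  of_sub_of_mem_relations_of_eqOn rfl fun x hx => by
    simp only [ellK_integrand, IntegralRep.integrand_constMul, legK1, lineRep_integrand]
    exact ellKf_half hx

/-- `E_½ - (√2/2)·G_E ∈ relations`. -/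
theorem ellE_half_sub :
    of (ellE (kL ^ 2) (isAlgebraic_kL.pow 2) (sq_mem_Ioo kL kL_mem)) -
      of (legE1.constMul kL isAlgebraic_kL) ∈ relations :=
  of_sub_of_mem_relations_of_eqOn rfl fun x hx => by
    simp only [ellE_integrand, IntegralRep.integrand_constMul, legE1, lineRep_integrand]
    exact ellEf_half hx

/-- **`[K_½] = √2·[A₂]`** in `Q`. -/
theorem mkQ_ellK_half : mkQ (of (ellK (kL ^ 2) (isAlgebraic_kL.pow 2) (sq_mem_Ioo kL kL_mem))) =
    sqrtTwo • mkQ (of lemnA2) := by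
  rw [← mkQ_legK1, show sqrtTwo = ⟨Real.sqrt 2, mem_K₀_iff.mpr isAlgebraic_sqrtTwo⟩ from rfl,
    ← mkQ_constMul, mkQ_eq_mkQ_iff]
  exact ellK_half_sub

/-- **`[E_½] = (√2/2)·([A₂] + [B₂])`** in `Q`. -/
theorem mkQ_ellE_half : mkQ (of (ellE (kL ^ 2) (isAlgebraic_kL.pow 2) (sq_mem_Ioo kL kL_mem))) =
    (⟨kL, mem_K₀_iff.mpr isAlgebraic_kL⟩ : K₀) • (mkQ (of lemnA2) + mkQ (of lemnB2)) := by
  rw [← mkQ_legE1, ← mkQ_constMul, mkQ_eq_mkQ_iff]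
  exact ellE_half_sub

/-! ## The Landen step at `k = √2/2` -/

/-- **`[K_{λ₁}] = (1 + √2)·[A₂]`** in `Q`, `λ₁ = 12√2 - 16`. -/
theorem mkQ_ellK_landenOne :
    mkQ (of (ellK (landenMod kL) (isAlgebraic_landenMod isAlgebraic_kL) (landenMod_mem kL_mem))) =
      (1 + sqrtTwo) • mkQ (of lemnA2) := by
  rw [mkQ_ellK_landen kL isAlgebraic_kL kL_mem, mkQ_ellK_half, smul_smul]
  congr 1
  apply Subtype.ext
  show (1 + kL) * Real.sqrt 2 = 1 + Real.sqrt 2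
  rw [kL]
  nlinarith [Real.mul_self_sqrt (zero_le_two (α := ℝ))]

/-- **`K(k₁) = (1 + √2)·a`**, `k₁² = 12√2 - 16`, `a = ∫₀¹ dx/√(1-x⁴)`. -/
theorem ellK_landenOne_value :
    (ellK (landenMod kL) (isAlgebraic_landenMod isAlgebraic_kL) (landenMod_mem kL_mem)).value =
      (1 + Real.sqrt 2) * lemnA2.value := by
  have h := congrArg evalQ mkQ_ellK_landenOne
  rw [evalQ_mkQ, eval_of, evalQ_smul, evalQ_mkQ, eval_of] at h
  rw [h]; push_cast [coe_sqrtTwo]; ring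

/-- **`K(k₁)` is transcendental.** -/
theorem transcendental_ellK_landenOne : Transcendental ℚ
    (ellK (landenMod kL) (isAlgebraic_landenMod isAlgebraic_kL) (landenMod_mem kL_mem)).value := by
  rw [ellK_landenOne_value]
  intro h
  have hc : IsAlgebraic ℚ (1 + Real.sqrt 2)⁻¹ := (isAlgebraic_one.add isAlgebraic_sqrtTwo).inv
  have hne : (1 + Real.sqrt 2) ≠ 0 := by positivity
  refine transcendental_lemnA2_value ?_
  have h' := hc.mul h
  rwa [← mul_assoc, inv_mul_cancel₀ hne, one_mul] at h'

end LemniscaticOrbit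

end SoloBlind

end Summit.KontsevichZagierPeriods.KontsevichZagierPeriods.Theorems
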